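import Summits.HubbardSuperconductivity.HubbardSuperconductivity.Theorems.BalabanIRBirComplexStableXYRThinFormExact
import Summits.HubbardSuperconductivity.HubbardSuperconductivity.Theorems.BalabanIRBirComplexStableXYRStubThinFormCoercive
import Literature.MathematicalPhysics.QuantumFieldTheory.TorusChartPinnedGaussian
import Literature.MathematicalPhysics.QuantumFieldTheory.GaussianWeightExpectation
import HarnessLib

/-!
# Crux `BirComplexStableXYR`, line `fat-gaussian-defect-calculus`: stub G6 `stub_sectorNormalForm`

Registered stub (lead c8, wave 9, skeleton `Cruxes/BirComplexStableXYR/Lines/fat_gaussian_defect_calculus.lean`),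
helper (`--supports`) for the crux `Summit.HubbardSuperconductivity.HubbardSuperconductivity.Theses.BalabanIR.BirComplexStableXYR`:
**the Gaussian normal form of the pinned sector integrals.**

**Statement.** With the window-Hessian matrix `H` of the thin form (its entries supplied by hypothesis, the matrix of
`thinForm_d0_eq_hessianForm`) and its pinned block `H' = H|_{Λ∖0}`: for `K > 0`, `K • H'` is positive
definite, and for every `G`,
`∫ e^{−(K/2)Σ_s Q(P_s d₀(extZero ψ))} G(ψ) dψ = gaussZ(K • H') · ∫ G d N(0,(K • H')⁻¹)`.

**Proof.** Plumbing of landed results: (1) `Σ_s Q(P_s(d₀φ)) = φᵀHφ` (`Theorems.thinForm_d0_eq_hessianForm`, prover seat 1,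
under (U1)); (2) `H` is symmetric (its entries are symmetric products); (3) coercivity of the thin form on all real
`1`-cochains (`FSUnfolding.stub_thinFormCoercive`, (N)+(C)+`r ≥ 2`) gives `2c₀ Σ(d₀φ)² ≤ φᵀHφ`, hence the pinned block is
positive definite (`TorusChart.posDef_submatrix_of_d₀_coercive`, prover seat 0) and so is `K • H'`; (4) on pinned fields
`φ = extZero ψ` the form is `ψᵀH'ψ` (`TorusChart.dotProduct_mulVec_extZero`), and the Gaussian-weight / expectation identity
`∫ G·e^{−(β/2)yᵀH'y} = gaussZ(βH')·∫ G dN(0,(βH')⁻¹)` (`integral_pi_mul_exp_neg_half_mul_eq`, prover seat 0) concludes.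
No definition, no named fact; sorry-free. [folklore]
-/

set_option linter.dupNamespace false -- `Summit.<S>.<S>.Theorems…` repeats the summit name (D-0017 layout)

noncomputable section

namespace Summit.HubbardSuperconductivity.HubbardSuperconductivity.Theorems.FSUnfolding

open scoped BigOperators Matrix
open MeasureTheory ProbabilityTheory WithLp
open Literature.MathematicalPhysics.QuantumFieldTheory Literature.Probability.LatticeModels
open Summit.HubbardSuperconductivity.BirComplexStableXYNegative

/-- The window-Hessian matrix with the entries of `thinForm_d0_eq_hessianForm` is symmetric. [folklore] -/
theorem sectorNormalForm_isSymm {r : ℕ} (c : Table r) {L M : ℕ} [NeZero L] [NeZero M]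
    (H : Matrix (Λ L M) (Λ L M) ℝ)
    (hH : ∀ i j : Λ L M, H i j = (-(∑ k : Λ L M × ↥c.support, c k.2 *
        ((∑ w, ((k.2 : Freq r) w : ℝ) * (if sh L M k.1 w = i then (1 : ℝ) else 0) : ℝ) : ℂ) *
        ((∑ w, ((k.2 : Freq r) w : ℝ) * (if sh L M k.1 w = j then (1 : ℝ) else 0) : ℝ) : ℂ))).re) :
    H.IsSymm := by
  refine Matrix.IsSymm.ext fun i j => ?_
  rw [hH i j, hH j i]
  congr 2
  exact Finset.sum_congr rfl fun k _ => by ring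

/-- **stub G6 (lead c8, wave 9): the Gaussian normal form of the pinned sector integrals.** [folklore] -/
theorem stub_sectorNormalForm :
    ∀ (r : ℕ) (c : Table r) (c₀ : ℝ), 2 ≤ r → 0 < c₀ → (∀ n ∈ c.support, ∑ w, n w = 0) →
      c.sum (fun _ a => a) = 0 →
      (∀ φ : W r → ℝ, c₀ * ∑ w, ∑ w', (1 - Real.cos (φ w - φ w')) ≤ (genF c φ).re) →
      ∀ (L M : ℕ) [NeZero L] [NeZero M]
      (P : (Λ L M → Fin 3 → ℝ) → Λ L M → W r → ℝ),
      (∀ (ω : Λ L M → Fin 3 → ℝ) (s : Λ L M) (w : W r), P ω s w =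
        (TorusChart.piProdZMod 2 L M).lineSum ω 0 (w.1 : ℕ) s
          + (TorusChart.piProdZMod 2 L M).lineSum ω 1 (w.2.1 : ℕ) (s + (w.1 : ℕ) • (TorusChart.piProdZMod 2 L M).gen 0)
          + (TorusChart.piProdZMod 2 L M).lineSum ω 2 (w.2.2 : ℕ)
            (s + (w.1 : ℕ) • (TorusChart.piProdZMod 2 L M).gen 0 + (w.2.1 : ℕ) • (TorusChart.piProdZMod 2 L M).gen 1)) →
      ∀ (Q : (W r → ℝ) → ℝ),
      (∀ u : W r → ℝ, Q u = (-c.sum (fun n a => a * (((∑ w, (n w : ℝ) * u w) ^ 2 : ℝ) : ℂ))).re) →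
      ∀ (H : Matrix (Λ L M) (Λ L M) ℝ),
      (∀ i j : Λ L M, H i j = (-(∑ k : Λ L M × ↥c.support, c k.2 *
          ((∑ w, ((k.2 : Freq r) w : ℝ) * (if sh L M k.1 w = i then (1 : ℝ) else 0) : ℝ) : ℂ) *
          ((∑ w, ((k.2 : Freq r) w : ℝ) * (if sh L M k.1 w = j then (1 : ℝ) else 0) : ℝ) : ℂ))).re) →
      ∀ (K : ℝ), 0 < K →
        (K • H.submatrix Subtype.val Subtype.val :
            Matrix (TorusChart.Punctured (Λ L M)) (TorusChart.Punctured (Λ L M)) ℝ).PosDef ∧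
        ∀ (G : (TorusChart.Punctured (Λ L M) → ℝ) → ℂ),
          ∫ ψ : TorusChart.Punctured (Λ L M) → ℝ,
              Complex.exp (-(((K / 2 * ∑ s : Λ L M, Q (P ((TorusChart.piProdZMod 2 L M).d₀
                (TorusChart.extZero ψ)) s)) : ℝ) : ℂ)) * G ψ =
            ((GaussianToolkit.gaussZ (K • H.submatrix Subtype.val Subtype.val :
                Matrix (TorusChart.Punctured (Λ L M)) (TorusChart.Punctured (Λ L M)) ℝ)).toReal : ℂ) *
              ∫ x, G (WithLp.ofLp x) ∂(ProbabilityTheory.multivariateGaussian 0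
                (K • H.submatrix Subtype.val Subtype.val :
                  Matrix (TorusChart.Punctured (Λ L M)) (TorusChart.Punctured (Λ L M)) ℝ)⁻¹) := by
  intro r c c₀ hr hc₀ hU1 hN hC L M _ _ P hP Q hQ H hH K hK
  set F := TorusChart.piProdZMod 2 L M with hF
  -- (1) the thin form is the `H`-form
  have hHeq : (Matrix.of fun i j : Λ L M => (-(∑ k : Λ L M × ↥c.support, c k.2 *
      ((∑ w, ((k.2 : Freq r) w : ℝ) * (if sh L M k.1 w = i then (1 : ℝ) else 0) : ℝ) : ℂ) *
      ((∑ w, ((k.2 : Freq r) w : ℝ) * (if sh L M k.1 w = j then (1 : ℝ) else 0) : ℝ) : ℂ))).re) = H := by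
    ext i j
    rw [Matrix.of_apply, hH i j]
  have hform : ∀ φ : Λ L M → ℝ, ∑ s : Λ L M, Q (P (F.d₀ φ) s) = φ ⬝ᵥ H *ᵥ φ := by
    intro φ
    simp only [hQ, hP, hF]
    rw [thinForm_d0_eq_hessianForm r c hU1 L M φ, hHeq]
  -- (2) symmetry and (3) coercivity ⇒ the pinned block is positive definite
  have hsymm : H.IsSymm := sectorNormalForm_isSymm c H hH
  have hcoer : ∀ φ : Λ L M → ℝ, 2 * c₀ * ∑ x : Λ L M, ∑ i : Fin 3, (F.d₀ φ x i) ^ 2 ≤ φ ⬝ᵥ H *ᵥ φ := by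
    intro φ
    refine (stub_thinFormCoercive r c c₀ hr hc₀ hN hC L M (F.d₀ φ)).trans_eq ?_
    rw [hF, thinForm_d0_eq_hessianForm r c hU1 L M φ, hHeq]
  have hpd : (H.submatrix Subtype.val Subtype.val :
      Matrix (TorusChart.Punctured (Λ L M)) (TorusChart.Punctured (Λ L M)) ℝ).PosDef :=
    TorusChart.posDef_submatrix_of_d₀_coercive F H hsymm (by positivity : (0 : ℝ) < 2 * c₀) hcoer
  refine ⟨hpd.smul hK, fun G => ?_⟩
  -- (4) pinned fields and the Gaussian-weight / expectation identity
  have hquad : ∀ ψ : TorusChart.Punctured (Λ L M) → ℝ,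
      ∑ s : Λ L M, Q (P (F.d₀ (TorusChart.extZero ψ)) s) =
        ψ ⬝ᵥ (H.submatrix Subtype.val Subtype.val) *ᵥ ψ := fun ψ => by
    rw [hform, TorusChart.dotProduct_mulVec_extZero]
  rw [← integral_pi_mul_exp_neg_half_mul_eq hpd hK G]
  refine integral_congr_ae (Filter.Eventually.of_forall fun ψ => ?_)
  show Complex.exp (-(((K / 2 * ∑ s : Λ L M, Q (P (F.d₀ (TorusChart.extZero ψ)) s)) : ℝ) : ℂ)) * G ψ =
    G ψ * (Real.exp (-(K / 2) * (ψ ⬝ᵥ (H.submatrix Subtype.val Subtype.val) *ᵥ ψ)) : ℂ)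
  rw [hquad ψ, mul_comm, Complex.ofReal_exp]
  congr 2
  push_cast
  ring

end Summit.HubbardSuperconductivity.HubbardSuperconductivity.Theorems.FSUnfolding

end
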